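import Literature.Analysis.FunctionSpaces.PolchinskiGaussianSmoothing
import HarnessLib

/-!
# Gaussian smoothings of bounded positive functions: derivatives dominated by powers of the function
# itself, and a Gaussian lower bound (the class of the renormalised potentials `V_s`, `s > 0`, of an
# initial potential that is merely measurable and bounded below — Bauerschmidt–Bodineau–Dagallier, Def 2)

Topic `Literature/Analysis/FunctionSpaces`; "proof architecture" file behind the named fact
`Polchinski.BauerschmidtBodineau_multiscaleBakryEmery` ([BBD] Theorem 3, `MultiscaleBakryEmery.lean`).

[BBD] Theorem 3 / [BB21] Theorem 5 are printed for an initial potential `V₀ : ℝ^N → ℝ` with no growth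
restriction (only `e^{−V₀}` integrable).  The tree's proof of Theorem 3 (`PolchinskiLogSobolev.lean`) needs
`V₀ ∈ C_b⁴`, and `PolchinskiRestart.lean` reduces a bounded measurable `V₀` to that class by restarting the
flow at a scale `s > 0` with `C_s ≻ 0`, where `V_s = −log Ψ`, `Ψ(x) = E_{C_s}[e^{−V₀}(x+η)]`.  When `V₀` is
only bounded BELOW, `Ψ = E_S[k(·+η)]` with `k = e^{−V₀}` measurable and `0 < k ≤ K`, but `1/Ψ` is unbounded
and `V_s ∉ C_b⁴`.  This file records what survives and suffices: writing `Ψ = G ∘ √S⁻¹` with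
`G(y) = E_γ[(k∘√S)(y+z)]` and using the Taylor series of Gaussian averages
(`hasFTaylorSeriesUpTo_integral_stdGaussian_comp_add`, Cameron–Martin), every derivative of `Ψ` is a
`k`-WEIGHTED Gaussian moment, `‖DⁿΨ(x)‖ ≤ c · E_γ[k(x + √S z)(‖z‖+1)ⁿ]`, hence by Hölder's inequality

  `‖DⁿΨ(x)‖ ≤ c_{n,m} · Ψ(x)^{1 − 1/m}`  for every `m ≥ 1`  (so `DⁿΨ/Ψ = O(Ψ^{−1/m})` for all `m`),

and by Jensen the same bound for Gaussian averages `E_P[DⁿΨ(y+ζ)]` against `E_P[Ψ(y+ζ)]`, for EVERY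
probability measure `P` with a constant independent of `P` (these are the "smoothed jets" of the flow,
`P = P_{C_t}`).  Also: `Ψ(x) ≥ c₁ e^{−c₂‖x‖²}` (Cameron–Martin again), `0 < Ψ ≤ K`, `Ψ ∈ C^∞` with all
derivatives bounded.

## Main results (sorry-free; no new definitions, no new named facts)

* `integral_mul_le_rpow_mul_rpow` — weighted Hölder on a probability space (Rudin RCA Thm 3.5):
  `E[k h] ≤ (E k)^{1−1/m} (K·E[hᵐ])^{1/m}` for `0 ≤ k ≤ K`, `h ≥ 0`; `integral_rpow_le_rpow_integral` —
  `E[k^{1−1/m}] ≤ (E k)^{1−1/m}`.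
* `norm_iteratedFDeriv_integral_stdGaussian_comp_add_le_weighted` — `‖Dⁿ_y E_γ[k(y+·)]‖ ≤ n!·E_γ[k(y+x)(‖x‖+1)ⁿ]`.
* **`exists_norm_iteratedFDeriv_smoothed_le_rpow`** — `‖DⁿΨ(x)‖ ≤ c · Ψ(x)^{1−1/m}` for
  `Ψ = E_S[k(·+η)]`, `S ≻ 0`, `0 ≤ k ≤ K` measurable.
* `exists_exp_neg_mul_norm_sq_le_smoothed` — `c₁ e^{−c₂‖x‖²} ≤ Ψ(x)` (`k > 0`).
* `exists_integral_norm_iteratedFDeriv_smoothed_le_rpow` — the averaged form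
  `E_P[‖DⁿΨ(y+ζ)‖] ≤ c · (E_P[Ψ(y+ζ)])^{1−1/m}` for every probability measure `P`.

Nothing here concerns Yang–Mills.

## References

* [BauerschmidtBodineauDagallier2023] R. Bauerschmidt, T. Bodineau, B. Dagallier, Probab. Surveys 21
  (2024) 200–290, arXiv:2307.07619 — Definition 2 p0013 (`V_t = −log E_{C_t}[e^{−V₀(·+ζ)}]`), Theorem 3
  p0015. READ (held text `paper:arxiv-2307.07619`).
* [BauerschmidtBodineau2021SineGordonLSI] R. Bauerschmidt, T. Bodineau, CPAM 74 (2021) §2.1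
  (`paper:arxiv-1907.12308` p0008: «for a potential `V₀ : ℝ^N → ℝ`»). READ.
* [Janson1997] S. Janson, *Gaussian Hilbert Spaces*, CUP 1997 — Theorem 14.1 (Cameron–Martin shift,
  (14.9)), PDF p0244–0245. READ (held text `book:janson1997-gaussian-hilbert-spaces`).
* [Rudin1987] W. Rudin, *Real and Complex Analysis*, 3rd ed. — Theorem 3.3 (Jensen), Theorem 3.5 (Hölder).
-/

noncomputable section

open MeasureTheory ProbabilityTheory Filter Topology Set
open scoped RealInnerProductSpace Matrix MatrixOrder ContDiff

namespace Literature.Analysis.FunctionSpaces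

namespace Polchinski

/-! ### 1. Weighted Hölder and Jensen on a probability space -/

section Holder

variable {α : Type*} [MeasurableSpace α] (P : Measure α) [IsProbabilityMeasure P]

/-- **Weighted Hölder inequality**: for measurable `0 ≤ k ≤ K` and `0 ≤ h` with `hᵐ` integrable,
`E[k h] ≤ (E k)^{1−1/m} · (K E[hᵐ])^{1/m}` (`k h = k^{1−1/m} · (k^{1/m} h)`, Hölder with exponents
`m/(m−1)` and `m`, then `k ≤ K` in the second factor; Hölder's inequality, Rudin, *Real and Complex
Analysis*, Theorem 3.5). [cite: Rudin1987, Theorem 3.5] -/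
theorem integral_mul_le_rpow_mul_rpow {k h : α → ℝ} (hkm : Measurable k) (hhm : Measurable h)
    (hk0 : ∀ z, 0 ≤ k z) {K : ℝ} (hkK : ∀ z, k z ≤ K) (hh0 : ∀ z, 0 ≤ h z) {m : ℕ} (hm : 1 ≤ m)
    (hInt : Integrable (fun z => h z ^ m) P) :
    ∫ z, k z * h z ∂P ≤ (∫ z, k z ∂P) ^ (1 - 1 / (m : ℝ)) * (K * ∫ z, h z ^ m ∂P) ^ (1 / (m : ℝ)) := by
  have hkhm : Integrable (fun z => k z * h z ^ m) P := by
    refine Integrable.mono' (hInt.const_mul K) (hkm.mul (hhm.pow_const m)).aestronglyMeasurable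
      (Eventually.of_forall fun z => ?_)
    rw [Real.norm_eq_abs, abs_of_nonneg (mul_nonneg (hk0 z) (pow_nonneg (hh0 z) m))]
    exact mul_le_mul_of_nonneg_right (hkK z) (pow_nonneg (hh0 z) m)
  have hIkh : ∫ z, k z * h z ^ m ∂P ≤ K * ∫ z, h z ^ m ∂P := by
    rw [← integral_const_mul]
    exact integral_mono hkhm (hInt.const_mul K) fun z =>
      mul_le_mul_of_nonneg_right (hkK z) (pow_nonneg (hh0 z) m)
  rcases Nat.lt_or_ge m 2 with hm1 | hm2
  · -- `m = 1`
    have hm1' : m = 1 := by omega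
    subst hm1'
    simp only [Nat.cast_one, div_one, sub_self, Real.rpow_zero, one_mul, pow_one, Real.rpow_one]
    simp only [pow_one] at hIkh
    exact hIkh
  -- `m ≥ 2`: Hölder with `p = m/(m-1)`, `q = m`
  have hmR : (2 : ℝ) ≤ m := by exact_mod_cast hm2
  have hm0 : (0 : ℝ) < m := by linarith
  set a : ℝ := 1 - 1 / (m : ℝ) with ha
  set b : ℝ := 1 / (m : ℝ) with hb
  have ha0 : 0 < a := by
    rw [ha]
    have : 1 / (m : ℝ) ≤ 1 / 2 := by
      rw [div_le_div_iff₀ hm0 (by norm_num)]; linarith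
    linarith
  have hb0 : 0 < b := by rw [hb]; positivity
  have hab : a + b = 1 := by rw [ha, hb]; ring
  have hpq : (1 / a).HolderConjugate (1 / b) := Real.holderConjugate_one_div ha0 hb0 hab
  have h1b : 1 / b = (m : ℝ) := by rw [hb, one_div_one_div]
  -- the two Hölder factors
  set f : α → ℝ := fun z => k z ^ a with hf
  set g : α → ℝ := fun z => k z ^ b * h z with hg
  have hf0 : ∀ z, 0 ≤ f z := fun z => Real.rpow_nonneg (hk0 z) _
  have hg0 : ∀ z, 0 ≤ g z := fun z => mul_nonneg (Real.rpow_nonneg (hk0 z) _) (hh0 z)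
  have hfm : Measurable f := hkm.pow_const a
  have hgm : Measurable g := (hkm.pow_const b).mul hhm
  have hfg : ∀ z, f z * g z = k z * h z := by
    intro z
    simp only [hf, hg]
    rw [← mul_assoc, ← Real.rpow_add' (hk0 z) (by rw [hab]; norm_num), hab, Real.rpow_one]
  have hfp : ∀ z, f z ^ (1 / a) = k z := by
    intro z
    simp only [hf]
    rw [← Real.rpow_mul (hk0 z), mul_one_div_cancel ha0.ne', Real.rpow_one]
  have hgq : ∀ z, g z ^ (1 / b) = k z * h z ^ m := by
    intro z
    simp only [hg]
    rw [Real.mul_rpow (Real.rpow_nonneg (hk0 z) _) (hh0 z), ← Real.rpow_mul (hk0 z),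
      mul_one_div_cancel hb0.ne', Real.rpow_one, h1b, Real.rpow_natCast]
  -- `MemLp` of the factors
  have hfLp : MemLp f (ENNReal.ofReal (1 / a)) P := by
    refine MemLp.of_bound hfm.aestronglyMeasurable (K ^ a) (Eventually.of_forall fun z => ?_)
    rw [Real.norm_eq_abs, abs_of_nonneg (hf0 z)]
    exact Real.rpow_le_rpow (hk0 z) (hkK z) ha0.le
  have hgLp : MemLp g (ENNReal.ofReal (1 / b)) P := by
    have hq0 : ENNReal.ofReal (1 / b) ≠ 0 := by
      rw [Ne, ENNReal.ofReal_eq_zero, not_le]; positivity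
    rw [← integrable_norm_rpow_iff hgm.aestronglyMeasurable hq0 ENNReal.ofReal_ne_top,
      ENNReal.toReal_ofReal (by positivity)]
    refine (hkhm.congr (Eventually.of_forall fun z => ?_))
    show k z * h z ^ m = ‖g z‖ ^ (1 / b)
    rw [Real.norm_eq_abs, abs_of_nonneg (hg0 z), hgq z]
  have hH := integral_mul_le_Lp_mul_Lq_of_nonneg hpq (Eventually.of_forall hf0)
    (Eventually.of_forall hg0) hfLp hgLp
  simp only [hfg, hfp, hgq, one_div_one_div] at hH
  -- assemble
  have hIk0 : 0 ≤ ∫ z, k z ∂P := integral_nonneg hk0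
  have hIkh0 : 0 ≤ ∫ z, k z * h z ^ m ∂P := integral_nonneg fun z => mul_nonneg (hk0 z) (pow_nonneg (hh0 z) m)
  calc ∫ z, k z * h z ∂P ≤ (∫ z, k z ∂P) ^ a * (∫ z, k z * h z ^ m ∂P) ^ b := hH
    _ ≤ (∫ z, k z ∂P) ^ a * (K * ∫ z, h z ^ m ∂P) ^ b := by
        refine mul_le_mul_of_nonneg_left ?_ (Real.rpow_nonneg hIk0 _)
        exact Real.rpow_le_rpow hIkh0 hIkh hb0.le

/-- **Jensen for the concave power `t ↦ t^{1−1/m}`** on a probability space: `E[k^{1−1/m}] ≤ (E k)^{1−1/m}`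
for measurable `0 ≤ k ≤ K` (Hölder against the constant `1`; Jensen's inequality, Rudin, *Real and Complex
Analysis*, Theorem 3.3). [cite: Rudin1987, Theorem 3.3] -/
theorem integral_rpow_le_rpow_integral {k : α → ℝ} (hkm : Measurable k) (hk0 : ∀ z, 0 ≤ k z) {K : ℝ}
    (hkK : ∀ z, k z ≤ K) {m : ℕ} (hm : 1 ≤ m) :
    ∫ z, k z ^ (1 - 1 / (m : ℝ)) ∂P ≤ (∫ z, k z ∂P) ^ (1 - 1 / (m : ℝ)) := by
  rcases Nat.lt_or_ge m 2 with hm1 | hm2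
  · have hm1' : m = 1 := by omega
    subst hm1'
    simp only [Nat.cast_one, div_one, sub_self, Real.rpow_zero, integral_const, smul_eq_mul,
      probReal_univ, mul_one, le_refl]
  have hmR : (2 : ℝ) ≤ m := by exact_mod_cast hm2
  have hm0 : (0 : ℝ) < m := by linarith
  set a : ℝ := 1 - 1 / (m : ℝ) with ha
  set b : ℝ := 1 / (m : ℝ) with hb
  have ha0 : 0 < a := by
    rw [ha]
    have : 1 / (m : ℝ) ≤ 1 / 2 := by
      rw [div_le_div_iff₀ hm0 (by norm_num)]; linarith
    linarith
  have hb0 : 0 < b := by rw [hb]; positivity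
  have hab : a + b = 1 := by rw [ha, hb]; ring
  have hpq : (1 / a).HolderConjugate (1 / b) := Real.holderConjugate_one_div ha0 hb0 hab
  set f : α → ℝ := fun z => k z ^ a with hf
  have hf0 : ∀ z, 0 ≤ f z := fun z => Real.rpow_nonneg (hk0 z) _
  have hfm : Measurable f := hkm.pow_const a
  have hfp : ∀ z, f z ^ (1 / a) = k z := by
    intro z
    simp only [hf]
    rw [← Real.rpow_mul (hk0 z), mul_one_div_cancel ha0.ne', Real.rpow_one]
  have hfLp : MemLp f (ENNReal.ofReal (1 / a)) P := by
    refine MemLp.of_bound hfm.aestronglyMeasurable (K ^ a) (Eventually.of_forall fun z => ?_)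
    rw [Real.norm_eq_abs, abs_of_nonneg (hf0 z)]
    exact Real.rpow_le_rpow (hk0 z) (hkK z) ha0.le
  have hgLp : MemLp (fun _ : α => (1 : ℝ)) (ENNReal.ofReal (1 / b)) P := memLp_const 1
  have hH := integral_mul_le_Lp_mul_Lq_of_nonneg hpq (Eventually.of_forall hf0)
    (Eventually.of_forall fun _ => zero_le_one) hfLp hgLp
  simp only [hfp, mul_one, Real.one_rpow, integral_const, smul_eq_mul, probReal_univ,
    one_div_one_div] at hH
  simpa only [hf] using hH

end Holder

/-! ### 2. Weighted derivative bounds for standard Gaussian averages -/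

section StdWeighted

variable {E : Type*} [NormedAddCommGroup E] [InnerProductSpace ℝ E] [FiniteDimensional ℝ E]
  [MeasurableSpace E] [BorelSpace E]

omit [InnerProductSpace ℝ E] [FiniteDimensional ℝ E] [MeasurableSpace E] [BorelSpace E] in
/-- `(‖x‖ + 1)ⁿ ≤ 2ⁿ (‖x‖ⁿ + 1)`. [folklore] -/
private theorem norm_add_one_pow_le (x : E) (n : ℕ) : (‖x‖ + 1) ^ n ≤ 2 ^ n * (‖x‖ ^ n + 1) := by
  have h1 : ‖x‖ + 1 ≤ 2 * max ‖x‖ 1 := by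
    rcases le_total ‖x‖ 1 with h | h
    · rw [max_eq_right h]; linarith
    · rw [max_eq_left h]; linarith
  have h2 : (max ‖x‖ 1) ^ n ≤ ‖x‖ ^ n + 1 := by
    rcases le_total ‖x‖ 1 with h | h
    · rw [max_eq_right h, one_pow]; linarith [pow_nonneg (norm_nonneg x) n]
    · rw [max_eq_left h]; linarith
  calc (‖x‖ + 1) ^ n ≤ (2 * max ‖x‖ 1) ^ n := pow_le_pow_left₀ (by positivity) h1 n
    _ = 2 ^ n * (max ‖x‖ 1) ^ n := mul_pow _ _ _
    _ ≤ 2 ^ n * (‖x‖ ^ n + 1) := mul_le_mul_of_nonneg_left h2 (by positivity)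

/-- The Gaussian moments `E_γ[(‖x‖ + 1)ⁿ]` are finite. [folklore] -/
private theorem integrable_norm_add_one_pow_stdGaussian (n : ℕ) :
    Integrable (fun x : E => (‖x‖ + 1) ^ n) (stdGaussian E) := by
  have hn : Integrable (fun x : E => ‖x‖ ^ n) (stdGaussian E) := by
    rcases Nat.eq_zero_or_pos n with h0 | hpos
    · subst h0; simp
    · have h := (IsGaussian.memLp_id (stdGaussian E) n (by simp)).integrable_norm_pow hpos.ne'
      simpa using h
  refine Integrable.mono' ((hn.add (integrable_const 1)).const_mul (2 ^ n)) (by fun_prop)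
    (Eventually.of_forall fun x => ?_)
  rw [Real.norm_eq_abs, abs_of_nonneg (by positivity)]
  exact norm_add_one_pow_le x n

variable {k : E → ℝ} {K : ℝ}

/-- **Weighted derivative bound for a Gaussian average**: for measurable `0 ≤ k ≤ K`,
`‖Dⁿ_y E_γ[k(y + ·)]‖ ≤ n! · E_γ[k(y + x)(‖x‖ + 1)ⁿ]` — the Taylor coefficient at `y` is
`E_γ[k(y+x) Dⁿtilt_x(0)]` with `‖Dⁿtilt_x(0)‖ ≤ n!(‖x‖+1)ⁿ` (Cameron–Martin, Janson 1997 Thm 14.1; the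
unweighted form is `norm_iteratedFDeriv_integral_stdGaussian_comp_add_le`). [cite: Janson1997, Theorem 14.1] -/
theorem norm_iteratedFDeriv_integral_stdGaussian_comp_add_le_weighted (hk : Measurable k)
    (hk0 : ∀ z, 0 ≤ k z) (hK : ∀ z, k z ≤ K) (n : ℕ) (y : E) :
    ‖iteratedFDeriv ℝ n (fun y : E => ∫ x, k (y + x) ∂stdGaussian E) y‖ ≤
      n.factorial * ∫ x, k (y + x) * (‖x‖ + 1) ^ n ∂stdGaussian E := by
  have hKabs : ∀ z, |k z| ≤ K := fun z => by rw [abs_of_nonneg (hk0 z)]; exact hK z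
  set ky : E → ℝ := fun z => k (y + z) with hky
  have hkym : Measurable ky := hk.comp (measurable_const_add y)
  have hkyK : ∀ z, |ky z| ≤ K := fun z => hKabs _
  have htr : iteratedFDeriv ℝ n (fun y : E => ∫ x, k (y + x) ∂stdGaussian E) y =
      iteratedFDeriv ℝ n (fun u : E => ∫ x, ky (u + x) ∂stdGaussian E) 0 := by
    have hfun : (fun u : E => ∫ x, ky (u + x) ∂stdGaussian E) =
        fun u => (fun y : E => ∫ x, k (y + x) ∂stdGaussian E) (y + u) := by
      funext u
      simp only [hky, add_assoc]
    rw [hfun, iteratedFDeriv_comp_add_left' (𝕜 := ℝ)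
      (f := fun y : E => ∫ x, k (y + x) ∂stdGaussian E) n y]
    simp only [add_zero]
  have hn : (n : ℕ∞ω) ≤ ∞ := by exact_mod_cast le_top
  rw [htr, ← (hasFTaylorSeriesUpTo_integral_stdGaussian_comp_add hkym hkyK).eq_iteratedFDeriv hn 0]
  have hint : Integrable (fun x : E => (n.factorial : ℝ) * (ky x * (‖x‖ + 1) ^ n)) (stdGaussian E) := by
    have h0 := integrable_norm_add_one_pow_stdGaussian (E := E) n
    have hmeas : Measurable fun x : E => ky x * (‖x‖ + 1) ^ n := hkym.mul (by fun_prop)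
    refine (Integrable.mono' (h0.const_mul K) hmeas.aestronglyMeasurable
      (Eventually.of_forall fun x => ?_)).const_mul _
    have hx0 : 0 ≤ (‖x‖ + 1) ^ n := by positivity
    rw [Real.norm_eq_abs, abs_of_nonneg (mul_nonneg (hk0 _) hx0)]
    exact mul_le_mul_of_nonneg_right (hK _) hx0
  calc ‖∫ x, ky x • iteratedFDeriv ℝ n (fun y : E => Real.exp (⟪x, y⟫ - ‖y‖ ^ 2 / 2)) 0
        ∂stdGaussian E‖
      ≤ ∫ x, (n.factorial : ℝ) * (ky x * (‖x‖ + 1) ^ n) ∂stdGaussian E := by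
        refine norm_integral_le_of_norm_le hint (Eventually.of_forall fun x => ?_)
        rw [norm_smul, Real.norm_eq_abs, abs_of_nonneg (hk0 _)]
        calc ky x * ‖iteratedFDeriv ℝ n (fun y : E => Real.exp (⟪x, y⟫ - ‖y‖ ^ 2 / 2)) 0‖
            ≤ ky x * ((n.factorial : ℝ) * (‖x‖ + 1) ^ n) :=
              mul_le_mul_of_nonneg_left (norm_iteratedFDeriv_tilt_zero_le x n) (hk0 _)
          _ = (n.factorial : ℝ) * (ky x * (‖x‖ + 1) ^ n) := by ring
    _ = n.factorial * ∫ x, k (y + x) * (‖x‖ + 1) ^ n ∂stdGaussian E := integral_const_mul _ _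

/-- **Gaussian lower bound for a Gaussian average of a positive function**: for measurable `0 < k ≤ K`,
`E_γ[k(y + ·)] ≥ c₁ e^{−‖y‖²}` with `c₁ = E_γ[e^{−‖z‖²/2} k(z)] > 0` (Cameron–Martin:
`E_γ[k(y+z)] = E_γ[e^{⟨z,y⟩−‖y‖²/2}k(z)]` and `⟨z,y⟩ ≥ −‖z‖²/2 − ‖y‖²/2`). [cite: Janson1997, Theorem 14.1] -/
theorem exists_exp_neg_norm_sq_le_integral_stdGaussian_comp_add (hk : Measurable k)
    (hk0 : ∀ z, 0 < k z) (hK : ∀ z, k z ≤ K) :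
    ∃ c₁ : ℝ, 0 < c₁ ∧ ∀ y : E, c₁ * Real.exp (-‖y‖ ^ 2) ≤ ∫ x, k (y + x) ∂stdGaussian E := by
  have hK0 : 0 ≤ K := (hk0 0).le.trans (hK 0)
  set c₁ : ℝ := ∫ z, Real.exp (-(‖z‖ ^ 2 / 2)) * k z ∂stdGaussian E with hc₁
  have hint0 : Integrable (fun z : E => Real.exp (-(‖z‖ ^ 2 / 2)) * k z) (stdGaussian E) := by
    refine Integrable.mono' (integrable_const K) (by fun_prop) (Eventually.of_forall fun z => ?_)
    rw [Real.norm_eq_abs, abs_of_nonneg (mul_nonneg (Real.exp_pos _).le (hk0 z).le)]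
    calc Real.exp (-(‖z‖ ^ 2 / 2)) * k z ≤ 1 * k z := by
          refine mul_le_mul_of_nonneg_right ?_ (hk0 z).le
          rw [Real.exp_le_one_iff]
          have : 0 ≤ ‖z‖ ^ 2 / 2 := by positivity
          linarith
      _ ≤ K := by rw [one_mul]; exact hK z
  have hc₁0 : 0 < c₁ := by
    rw [hc₁, integral_pos_iff_support_of_nonneg (fun z => mul_nonneg (Real.exp_pos _).le (hk0 z).le)
      hint0]
    have hsupp : Function.support (fun z : E => Real.exp (-(‖z‖ ^ 2 / 2)) * k z) = univ := by
      ext z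
      simp only [Function.mem_support, ne_eq, mem_univ, iff_true]
      exact (mul_pos (Real.exp_pos _) (hk0 z)).ne'
    rw [hsupp, measure_univ]
    exact one_pos
  refine ⟨c₁, hc₁0, fun y => ?_⟩
  rw [integral_stdGaussian_comp_add k y]
  have hint1 : Integrable (fun z : E => Real.exp (⟪z, y⟫ - ‖y‖ ^ 2 / 2) * k z) (stdGaussian E) := by
    -- the Wick exponential has mean one, in particular it is integrable
    have hW : Integrable (fun z : E => Real.exp (⟪z, y⟫ - ‖y‖ ^ 2 / 2)) (stdGaussian E) :=
      Integrable.of_integral_ne_zero (by rw [integral_stdGaussian_exp_inner_sub y]; exact one_ne_zero)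
    refine Integrable.mono' (hW.const_mul K) (by fun_prop) (Eventually.of_forall fun z => ?_)
    rw [Real.norm_eq_abs, abs_of_nonneg (mul_nonneg (Real.exp_pos _).le (hk0 z).le)]
    calc Real.exp (⟪z, y⟫ - ‖y‖ ^ 2 / 2) * k z ≤ Real.exp (⟪z, y⟫ - ‖y‖ ^ 2 / 2) * K :=
          mul_le_mul_of_nonneg_left (hK z) (Real.exp_pos _).le
      _ = K * Real.exp (⟪z, y⟫ - ‖y‖ ^ 2 / 2) := by ring
  calc c₁ * Real.exp (-‖y‖ ^ 2)
      = ∫ z, Real.exp (-‖y‖ ^ 2) * (Real.exp (-(‖z‖ ^ 2 / 2)) * k z) ∂stdGaussian E := by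
        rw [integral_const_mul, mul_comm]
    _ ≤ ∫ z, Real.exp (⟪z, y⟫ - ‖y‖ ^ 2 / 2) * k z ∂stdGaussian E := by
        refine integral_mono_of_nonneg (Eventually.of_forall fun z =>
          mul_nonneg (Real.exp_pos _).le (mul_nonneg (Real.exp_pos _).le (hk0 z).le)) hint1
          (Eventually.of_forall fun z => ?_)
        show Real.exp (-‖y‖ ^ 2) * (Real.exp (-(‖z‖ ^ 2 / 2)) * k z) ≤ _
        rw [← mul_assoc, ← Real.exp_add]
        refine mul_le_mul_of_nonneg_right (Real.exp_le_exp.2 ?_) (hk0 z).le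
        have h1 : -(‖z‖ * ‖y‖) ≤ ⟪z, y⟫ := by
          have := abs_real_inner_le_norm z y
          rw [abs_le] at this
          linarith [this.1]
        nlinarith [sq_nonneg (‖z‖ - ‖y‖), norm_nonneg z, norm_nonneg y]

end StdWeighted

/-! ### 3. Smoothing by a nondegenerate Gaussian `S ≻ 0` -/

section Smoothed

variable {ι : Type*} [Fintype ι] [DecidableEq ι]

/-- `‖√S z‖² = ⟨z, S z⟩` for positive semidefinite `S`. [folklore] -/
private theorem norm_sqrt_apply_sq₄ {S : Matrix ι ι ℝ} (hS : S.PosSemidef) (z : EuclideanSpace ℝ ι) :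
    ‖Matrix.toEuclideanCLM (𝕜 := ℝ) (CFC.sqrt S) z‖ ^ 2 = ⟪z, Matrix.toEuclideanLin S z⟫ := by
  set T := Matrix.toEuclideanCLM (𝕜 := ℝ) (CFC.sqrt S) with hT
  have hsa : IsSelfAdjoint T := (CFC.sqrt_nonneg S).isSelfAdjoint.map _
  rw [← real_inner_self_eq_norm_sq, ← ContinuousLinearMap.adjoint_inner_right, hsa.adjoint_eq,
    ← ContinuousLinearMap.comp_apply, ← ContinuousLinearMap.mul_def, hT, ← map_mul,
    CFC.sqrt_mul_sqrt_self _ hS.nonneg]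
  rfl

/-- For `S ≻ 0` the square root `√S` is a linear homeomorphism of `ℝ^ι`. [folklore] -/
private theorem exists_equiv_sqrt' {S : Matrix ι ι ℝ} (hS : S.PosDef) :
    ∃ e : EuclideanSpace ℝ ι ≃L[ℝ] EuclideanSpace ℝ ι,
      (e : EuclideanSpace ℝ ι →L[ℝ] EuclideanSpace ℝ ι) =
        Matrix.toEuclideanCLM (𝕜 := ℝ) (CFC.sqrt S) := by
  obtain ⟨c, hc, hSc⟩ := exists_pos_mul_norm_sq_le_inner_of_posDef hS
  set T := Matrix.toEuclideanCLM (𝕜 := ℝ) (CFC.sqrt S) with hT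
  have hTsq : ∀ z, c * ‖z‖ ^ 2 ≤ ‖T z‖ ^ 2 := fun z => by
    rw [hT, norm_sqrt_apply_sq₄ hS.posSemidef]; exact hSc z
  have hinj : Function.Injective T := by
    intro x y hxy
    have h0 : T (x - y) = 0 := by rw [map_sub, hxy, sub_self]
    have h1 := hTsq (x - y)
    rw [h0, norm_zero] at h1
    have h1' : c * ‖x - y‖ ^ 2 ≤ 0 := by simpa using h1
    have h2 : ‖x - y‖ ^ 2 ≤ 0 := by
      by_contra hne
      exact absurd h1' (not_le.2 (mul_pos hc (not_le.1 hne)))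
    have h3 : ‖x - y‖ = 0 := by nlinarith [norm_nonneg (x - y)]
    exact sub_eq_zero.1 (norm_eq_zero.1 h3)
  have hsurj : Function.Surjective T :=
    LinearMap.surjective_of_injective (f := (T : EuclideanSpace ℝ ι →ₗ[ℝ] EuclideanSpace ℝ ι)) hinj
  let eₗ : EuclideanSpace ℝ ι ≃ₗ[ℝ] EuclideanSpace ℝ ι :=
    LinearEquiv.ofBijective (T : EuclideanSpace ℝ ι →ₗ[ℝ] EuclideanSpace ℝ ι) ⟨hinj, hsurj⟩
  refine ⟨eₗ.toContinuousLinearEquiv, ?_⟩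
  ext v
  rfl

variable {S : Matrix ι ι ℝ} {k : EuclideanSpace ℝ ι → ℝ} {K : ℝ}

/-- **The transported representation.**  For `S ≻ 0` there are a linear homeomorphism `e` of `ℝ^ι`
(`e = √S`) such that `E_S[k(x + η)] = E_γ[(k ∘ √S)(√S⁻¹ x + z)]` for every measurable bounded `k` and
every `x`, and more generally `E_S[g(x, η)]`-type averages transport along `η = √S z`:
`∫ k(x + η) h(η) dP_S = ∫ k(x + √S z) h(√S z) dγ`. [folklore] -/
private theorem exists_equiv_repr (hS : S.PosDef) :
    ∃ e : EuclideanSpace ℝ ι ≃L[ℝ] EuclideanSpace ℝ ι,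
      ((e : EuclideanSpace ℝ ι →L[ℝ] EuclideanSpace ℝ ι) =
        Matrix.toEuclideanCLM (𝕜 := ℝ) (CFC.sqrt S)) ∧
      ∀ (g : EuclideanSpace ℝ ι → ℝ), Measurable g → ∀ x : EuclideanSpace ℝ ι,
        ∫ η, g (x + η) ∂multivariateGaussian 0 S =
          ∫ z, (fun u => g (e u)) (e.symm x + z) ∂stdGaussian (EuclideanSpace ℝ ι) := by
  obtain ⟨e, he⟩ := exists_equiv_sqrt' hS
  refine ⟨e, he, fun g hg x => ?_⟩
  set T := Matrix.toEuclideanCLM (𝕜 := ℝ) (CFC.sqrt S) with hT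
  have hmeas : AEMeasurable (fun x : EuclideanSpace ℝ ι => (0 : EuclideanSpace ℝ ι) + T x)
      (stdGaussian (EuclideanSpace ℝ ι)) := by fun_prop
  have hmx : Measurable fun η => g (x + η) := hg.comp (measurable_const_add x)
  rw [multivariateGaussian, ← hT, integral_map hmeas hmx.aestronglyMeasurable]
  refine integral_congr_ae (Eventually.of_forall fun z => ?_)
  simp only [zero_add]
  have h1 : e (e.symm x + z) = x + T z := by
    rw [map_add, e.apply_symm_apply, ← ContinuousLinearEquiv.coe_coe, he]
  rw [h1]

/-- **Basic properties of the smoothing `Ψ = E_S[k(·+η)]`** of a measurable `0 < k ≤ K` by `S ≻ 0`: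
`0 < Ψ ≤ K`, `Ψ` measurable. [cite: BauerschmidtBodineauDagallier2023, Definition 2] -/
theorem smoothed_pos_le (hk : Measurable k) (hk0 : ∀ z, 0 < k z) (hK : ∀ z, k z ≤ K)
    (x : EuclideanSpace ℝ ι) :
    0 < ∫ η, k (x + η) ∂multivariateGaussian 0 S ∧ ∫ η, k (x + η) ∂multivariateGaussian 0 S ≤ K := by
  have hmx : Measurable fun η => k (x + η) := hk.comp (measurable_const_add x)
  have hint : Integrable (fun η => k (x + η)) (multivariateGaussian 0 S) :=
    Integrable.mono' (integrable_const K) hmx.aestronglyMeasurable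
      (Eventually.of_forall fun η => by rw [Real.norm_eq_abs, abs_of_pos (hk0 _)]; exact hK _)
  constructor
  · rw [integral_pos_iff_support_of_nonneg (fun η => (hk0 _).le) hint]
    have hsupp : Function.support (fun η => k (x + η)) = univ := by
      ext η; simp [(hk0 (x + η)).ne']
    rw [hsupp, measure_univ]; exact one_pos
  · have h := integral_mono hint (integrable_const K) fun η => hK (x + η)
    simpa using h

/-- Measurability of `x ↦ E_S[k(x + η)]`. [folklore] -/
private theorem measurable_smoothed (hk : Measurable k) (S : Matrix ι ι ℝ) :
    Measurable fun x : EuclideanSpace ℝ ι => ∫ η, k (x + η) ∂multivariateGaussian 0 S := by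
  have hsm : StronglyMeasurable
      (Function.uncurry fun (x η : EuclideanSpace ℝ ι) => k (x + η)) :=
    (hk.comp (measurable_fst.add measurable_snd)).stronglyMeasurable
  exact (hsm.integral_prod_right (ν := multivariateGaussian 0 S)).measurable

/-- **Derivatives of a nondegenerate Gaussian smoothing are dominated by powers of the smoothing itself**:
for `S ≻ 0`, measurable `0 ≤ k ≤ K`, `Ψ(x) = E_S[k(x + η)]` and all `n`, `m ≥ 1` there is `c ≥ 0` with
`‖DⁿΨ(x)‖ ≤ c · Ψ(x)^{1 − 1/m}` for every `x` (weighted Taylor coefficients + Hölder; the constant involves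
`n!`, `‖√S⁻¹‖ⁿ`, `K^{1/m}` and the Gaussian moment `E_γ[(‖z‖+1)^{nm}]`).  For `k = e^{−V₀}` this is the
regularity of `e^{−V_s}`, [BBD] Def 2, when `V₀` is only bounded below.
[cite: BauerschmidtBodineauDagallier2023, Definition 2] -/
theorem exists_norm_iteratedFDeriv_smoothed_le_rpow (hS : S.PosDef) (hk : Measurable k)
    (hk0 : ∀ z, 0 ≤ k z) (hK : ∀ z, k z ≤ K) (n : ℕ) {m : ℕ} (hm : 1 ≤ m) :
    ∃ c : ℝ, 0 ≤ c ∧ ∀ x : EuclideanSpace ℝ ι,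
      ‖iteratedFDeriv ℝ n (fun x => ∫ η, k (x + η) ∂multivariateGaussian 0 S) x‖ ≤
        c * (∫ η, k (x + η) ∂multivariateGaussian 0 S) ^ (1 - 1 / (m : ℝ)) := by
  have hK0 : 0 ≤ K := (hk0 0).trans (hK 0)
  have hKabs : ∀ z, |k z| ≤ K := fun z => by rw [abs_of_nonneg (hk0 z)]; exact hK z
  obtain ⟨e, he, hrepr⟩ := exists_equiv_repr (S := S) hS
  set L : EuclideanSpace ℝ ι →L[ℝ] EuclideanSpace ℝ ι :=
    (e.symm : EuclideanSpace ℝ ι →L[ℝ] EuclideanSpace ℝ ι) with hL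
  set kT : EuclideanSpace ℝ ι → ℝ := fun u => k (e u) with hkT
  have hkTm : Measurable kT := hk.comp e.continuous.measurable
  have hkT0 : ∀ u, 0 ≤ kT u := fun u => hk0 _
  have hkTK : ∀ u, kT u ≤ K := fun u => hK _
  have hkTabs : ∀ u, |kT u| ≤ K := fun u => hKabs _
  set G : EuclideanSpace ℝ ι → ℝ := fun y => ∫ z, kT (y + z) ∂stdGaussian (EuclideanSpace ℝ ι) with hG
  have hΨ : (fun x => ∫ η, k (x + η) ∂multivariateGaussian 0 S) = G ∘ L := by
    funext x
    simp only [Function.comp, hG, hkT, hL]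
    exact hrepr k hk x
  have hGs : ContDiff ℝ ∞ G := contDiff_integral_stdGaussian_comp_add hkTm hkTabs
  -- constants
  set M : ℝ := ∫ z, (‖z‖ + 1) ^ (n * m) ∂stdGaussian (EuclideanSpace ℝ ι) with hM
  have hM0 : 0 ≤ M := integral_nonneg fun z => by positivity
  refine ⟨‖L‖ ^ n * (n.factorial * (K * M) ^ (1 / (m : ℝ))), by positivity, fun x => ?_⟩
  have hn : (n : ℕ∞ω) ≤ ∞ := by exact_mod_cast le_top
  rw [hΨ, ContinuousLinearMap.iteratedFDeriv_comp_right L hGs x hn]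
  refine (ContinuousMultilinearMap.norm_compContinuousLinearMap_le _ _).trans ?_
  rw [Finset.prod_const, Finset.card_univ, Fintype.card_fin]
  -- the weighted bound for `G` at `L x`, then Hölder
  have h1 := norm_iteratedFDeriv_integral_stdGaussian_comp_add_le_weighted hkTm hkT0 hkTK n (L x)
  have hInt : Integrable (fun z : EuclideanSpace ℝ ι => ((‖z‖ + 1) ^ n) ^ m)
      (stdGaussian (EuclideanSpace ℝ ι)) := by
    simpa only [← pow_mul] using integrable_norm_add_one_pow_stdGaussian (E := EuclideanSpace ℝ ι) (n * m)
  have h2 := integral_mul_le_rpow_mul_rpow (stdGaussian (EuclideanSpace ℝ ι))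
    (k := fun z => kT (L x + z)) (h := fun z => (‖z‖ + 1) ^ n) (hkTm.comp (measurable_const_add _))
    (by fun_prop) (fun z => hkT0 _) (fun z => hkTK _) (fun z => by positivity) hm hInt
  have hGx : ∫ z, kT (L x + z) ∂stdGaussian (EuclideanSpace ℝ ι) = (G ∘ L) x := rfl
  simp only [← pow_mul] at h2
  rw [hGx] at h2
  have hGL0 : 0 ≤ (G ∘ L) x := integral_nonneg fun z => hkT0 _
  have hx : (∫ η, k (x + η) ∂multivariateGaussian 0 S) = (G ∘ L) x := by
    have := congrFun hΨ x; simpa using this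
  rw [hx]
  calc ‖iteratedFDeriv ℝ n G (L x)‖ * ‖L‖ ^ n
      ≤ (n.factorial * ∫ z, kT (L x + z) * (‖z‖ + 1) ^ n ∂stdGaussian (EuclideanSpace ℝ ι)) *
          ‖L‖ ^ n := mul_le_mul_of_nonneg_right h1 (by positivity)
    _ ≤ (n.factorial * (((G ∘ L) x) ^ (1 - 1 / (m : ℝ)) * (K * M) ^ (1 / (m : ℝ)))) * ‖L‖ ^ n := by
        gcongr
    _ = ‖L‖ ^ n * (n.factorial * (K * M) ^ (1 / (m : ℝ))) * ((G ∘ L) x) ^ (1 - 1 / (m : ℝ)) := by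
        ring

/-- **Gaussian lower bound for a nondegenerate smoothing of a positive function**: for `S ≻ 0` and
measurable `0 < k ≤ K` there are `c₁ > 0`, `c₂ ≥ 0` with `c₁ e^{−c₂‖x‖²} ≤ E_S[k(x + η)]` for all `x`
(so `1/Ψ` has at most Gaussian growth; for `k = e^{−V₀}`: `V_s(x) ≤ c₂‖x‖² − log c₁`, [BBD] Def 2).
[cite: BauerschmidtBodineauDagallier2023, Definition 2] -/
theorem exists_exp_neg_mul_norm_sq_le_smoothed (hS : S.PosDef) (hk : Measurable k)
    (hk0 : ∀ z, 0 < k z) (hK : ∀ z, k z ≤ K) :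
    ∃ c₁ c₂ : ℝ, 0 < c₁ ∧ 0 ≤ c₂ ∧ ∀ x : EuclideanSpace ℝ ι,
      c₁ * Real.exp (-(c₂ * ‖x‖ ^ 2)) ≤ ∫ η, k (x + η) ∂multivariateGaussian 0 S := by
  obtain ⟨e, he, hrepr⟩ := exists_equiv_repr (S := S) hS
  set L : EuclideanSpace ℝ ι →L[ℝ] EuclideanSpace ℝ ι :=
    (e.symm : EuclideanSpace ℝ ι →L[ℝ] EuclideanSpace ℝ ι) with hL
  set kT : EuclideanSpace ℝ ι → ℝ := fun u => k (e u) with hkT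
  have hkTm : Measurable kT := hk.comp e.continuous.measurable
  obtain ⟨c₁, hc₁, hlow⟩ := exists_exp_neg_norm_sq_le_integral_stdGaussian_comp_add
    (E := EuclideanSpace ℝ ι) hkTm (fun u => hk0 _) (fun u => hK _)
  refine ⟨c₁, ‖L‖ ^ 2, hc₁, by positivity, fun x => ?_⟩
  rw [hrepr k hk x]
  refine le_trans ?_ (hlow (L x))
  refine mul_le_mul_of_nonneg_left (Real.exp_le_exp.2 ?_) hc₁.le
  have h := L.le_opNorm x
  have h2 : ‖L x‖ ^ 2 ≤ (‖L‖ * ‖x‖) ^ 2 := pow_le_pow_left₀ (norm_nonneg _) h 2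
  nlinarith

/-- **Averaged weighted bounds (the smoothed jets of the Polchinski flow)**: for `S ≻ 0`, measurable
`0 ≤ k ≤ K`, `Ψ = E_S[k(·+η)]`, `n` and `m ≥ 1` there is `c ≥ 0` such that for EVERY probability measure
`P` on `ℝ^ι` and every `y`, `E_P[‖DⁿΨ(y + ζ)‖] ≤ c · (E_P[Ψ(y + ζ)])^{1 − 1/m}` — pointwise domination and
Jensen; the constant does not depend on `P` (in the flow `P = P_{C_t}`, uniformly in `t`).
[cite: BauerschmidtBodineauDagallier2023, Definition 2] -/
theorem exists_integral_norm_iteratedFDeriv_smoothed_le_rpow (hS : S.PosDef) (hk : Measurable k)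
    (hk0 : ∀ z, 0 ≤ k z) (hK : ∀ z, k z ≤ K) (n : ℕ) {m : ℕ} (hm : 1 ≤ m) :
    ∃ c : ℝ, 0 ≤ c ∧ ∀ (P : Measure (EuclideanSpace ℝ ι)) [IsProbabilityMeasure P]
      (y : EuclideanSpace ℝ ι),
      Integrable (fun ζ => ‖iteratedFDeriv ℝ n
        (fun x => ∫ η, k (x + η) ∂multivariateGaussian 0 S) (y + ζ)‖) P ∧
      ∫ ζ, ‖iteratedFDeriv ℝ n (fun x => ∫ η, k (x + η) ∂multivariateGaussian 0 S) (y + ζ)‖ ∂P ≤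
        c * (∫ ζ, (∫ η, k ((y + ζ) + η) ∂multivariateGaussian 0 S) ∂P) ^ (1 - 1 / (m : ℝ)) := by
  have hK0 : 0 ≤ K := (hk0 0).trans (hK 0)
  have hKabs : ∀ z, |k z| ≤ K := fun z => by rw [abs_of_nonneg (hk0 z)]; exact hK z
  obtain ⟨c, hc, hpt⟩ := exists_norm_iteratedFDeriv_smoothed_le_rpow hS hk hk0 hK n hm
  obtain ⟨hCD, hbd⟩ := contDiff_integral_multivariateGaussian_comp_add hS hk hKabs
  obtain ⟨B, hB⟩ := hbd n
  set Ψ : EuclideanSpace ℝ ι → ℝ := fun x => ∫ η, k (x + η) ∂multivariateGaussian 0 S with hΨ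
  have hΨm : Measurable Ψ := measurable_smoothed hk S
  have hΨ0 : ∀ x, 0 ≤ Ψ x := fun x => integral_nonneg fun η => hk0 _
  have hΨK : ∀ x, Ψ x ≤ K := fun x => by
    have hmx : Measurable fun η => k (x + η) := hk.comp (measurable_const_add x)
    have hint : Integrable (fun η => k (x + η)) (multivariateGaussian 0 S) :=
      Integrable.mono' (integrable_const K) hmx.aestronglyMeasurable
        (Eventually.of_forall fun η => by rw [Real.norm_eq_abs]; exact hKabs _)
    have h := integral_mono hint (integrable_const K) fun η => hK (x + η)
    simpa using h
  have hcontD : Continuous fun x => ‖iteratedFDeriv ℝ n Ψ x‖ :=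
    (hCD.continuous_iteratedFDeriv (by exact_mod_cast le_top)).norm
  refine ⟨c, hc, fun P _ y => ?_⟩
  have hI1 : Integrable (fun ζ => ‖iteratedFDeriv ℝ n Ψ (y + ζ)‖) P :=
    Integrable.of_bound ((hcontD.comp (continuous_const.add continuous_id)).aestronglyMeasurable) B
      (Eventually.of_forall fun ζ => by rw [norm_norm]; exact hB _)
  have hI2 : Integrable (fun ζ => Ψ (y + ζ) ^ (1 - 1 / (m : ℝ))) P := by
    refine Integrable.of_bound (((hΨm.comp (measurable_const_add y)).pow_const _).aestronglyMeasurable)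
      (K ^ (1 - 1 / (m : ℝ))) (Eventually.of_forall fun ζ => ?_)
    rw [Real.norm_eq_abs, abs_of_nonneg (Real.rpow_nonneg (hΨ0 _) _)]
    refine Real.rpow_le_rpow (hΨ0 _) (hΨK _) ?_
    have : (1 : ℝ) / m ≤ 1 := by
      rw [div_le_one (by exact_mod_cast hm)]; exact_mod_cast hm
    linarith
  refine ⟨hI1, ?_⟩
  calc ∫ ζ, ‖iteratedFDeriv ℝ n Ψ (y + ζ)‖ ∂P
      ≤ ∫ ζ, c * Ψ (y + ζ) ^ (1 - 1 / (m : ℝ)) ∂P :=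
        integral_mono hI1 (hI2.const_mul c) fun ζ => hpt (y + ζ)
    _ = c * ∫ ζ, Ψ (y + ζ) ^ (1 - 1 / (m : ℝ)) ∂P := integral_const_mul _ _
    _ ≤ c * (∫ ζ, Ψ (y + ζ) ∂P) ^ (1 - 1 / (m : ℝ)) :=
        mul_le_mul_of_nonneg_left (integral_rpow_le_rpow_integral P (hΨm.comp (measurable_const_add y))
          (fun ζ => hΨ0 _) (fun ζ => hΨK _) hm) hc

end Smoothed

end Polchinski

end Literature.Analysis.FunctionSpaces

end
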